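import Summits.AtomisticToContinuum.BoseEinsteinCondensation.Theorems.BoxCountShadowCell
import HarnessLib

/-!
# BoxCountShadowInsertion — continuation of BoxCountShadowCell: the insertion form INS_h ⟺ MARG_h (§8)

Continuation of `BoxCountShadow{,B,C,Cell}` (same namespace).  The residual of record MARG_h
(`GroundStateHorizonCellCountAffinity`) in POINTWISE normal form: `pairWeight`/`pairWeightOn` (weight
`K⁻³ P̄_B(j)` of a (cell, count) pair), `cellCountAffinity_ge_of_insertion` / `insertion_of_cellCountAffinity`
(functional kernels), the piece `GroundStateHorizonCellInsertion` (INS_h) and the exact equivalence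
`horizonCellInsertion_iff_cellCountAffinity`.
No instances, no notation, no sorry.
-/

open MeasureTheory Filter Set
open scoped ENNReal NNReal BigOperators

namespace Summit.AtomisticToContinuum.BoseEinsteinCondensation.Theorems.BoxCountShadow

open Literature.MathematicalPhysics.QuantumManyBody.BoseGas
open Summit.AtomisticToContinuum.BoseEinsteinCondensation.Theorems.BoxLatticeFSum
open Summit.AtomisticToContinuum.BoseEinsteinCondensation.Theorems.BoxLabelAffinity
open Summit.AtomisticToContinuum.BoseEinsteinCondensation.Theorems.BoxHorizonAffinity

variable {n : ℕ}

/-! ### §8  Insertion form of the residual (exact), and (§8b) the displacement door (successor typing)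

MARG_h is EQUIVALENT to a pointwise statement on (cell, count) pairs: on a set `G` of pairs `(B,j)` of
non-negligible weight `Σ_{(B,j)∈G} K^{-3} P̄_B(j) ≥ δ` (weight = «uniform cell, its count among the others»), the
INSERTION PROPENSITY is at least `κ ×` fair share, `Q_B(j) ≥ κ·K^{-3}·P̄_B(j)` (INS_h;
`horizonCellInsertion_iff_cellCountAffinity`).  The door for the successor: DISPLACEMENT COMPARABILITY of adjacent
cells given the others (DISP_h: `κ₁·∫_{m_B=j} q_{B'} ≤ ∫_{m_B=j} q_B` for `B' ∈ nbrs B` — a one-coordinate,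
scale-`ℓ_h` Harnack statement, integrated over the count fibre) and RING SHARE (RSH_h: some adjacent cell receives
the tagged particle at rate `≥ θ·K^{-3}` on the fibre `m_B = j` — mild, density-class) give INS_h with `κ = κ₁θ`
(`horizonCellInsertion_of_displacement`).  LOCAL moves suffice for MARG_h; chaining them across the box (what NUM_h
would need from the same input) is exactly what CSUF_h saves. -/

/-- The weight `K^{-3}·P̄_B(j)` of the pair `(B, j)` («uniform cell, its count among the others»). [folklore] -/
noncomputable def pairWeight (L : ℝ) (K : ℕ) (Φ : Config (n + 1) → ℝ) (p : SubIdx K × ℕ) : ℝ≥0∞ :=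
  blockWeight K ^ 2 * cellSlice L K Φ p.1 p.2

/-- The weight of a set of pairs. [folklore] -/
noncomputable def pairWeightOn (L : ℝ) (K : ℕ) (Φ : Config (n + 1) → ℝ) (G : Set (SubIdx K × ℕ)) : ℝ≥0∞ :=
  ∑ B : SubIdx K, ∑' j : ℕ, G.indicator (pairWeight L K Φ) (B, j)

/-- Total pair weight `Σ_B K^{-3} Σ_j P̄_B(j) = 1` for a normalised amplitude. [folklore] -/
theorem pairWeightOn_univ {L : ℝ} {K : ℕ} (hK : 0 < K) {Φ : Config (n + 1) → ℝ}
    (hΦ1 : ∫⁻ Y : Config n, ∫⁻ x, ENNReal.ofReal (Φ (Matrix.vecCons x Y)) ^ 2 = 1) :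
    pairWeightOn L K Φ Set.univ = 1 := by
  have hT : ∀ B : SubIdx K,
      Measurable ((fun m : SubIdx K → ℕ => m B) ∘ countVec (n := n) (L / (K : ℝ)) K) :=
    fun B => (measurable_pi_apply B).comp (measurable_countVec (L / (K : ℝ)) K)
  have hS : ∀ B : SubIdx K, ∑' j : ℕ, cellSlice L K Φ B j = 1 := by
    intro B
    unfold cellSlice
    rw [← lintegral_eq_tsum_fibre volume (hT B) (sliceSq Φ)]
    exact hΦ1
  unfold pairWeightOn
  simp only [Set.indicator_univ]
  unfold pairWeight
  simp_rw [ENNReal.tsum_mul_left, hS, mul_one]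
  exact sum_blockWeight_sq hK

/-- Splitting the pair weight along a set and its complement. [folklore] -/
theorem pairWeightOn_add_compl (L : ℝ) (K : ℕ) (Φ : Config (n + 1) → ℝ) (G : Set (SubIdx K × ℕ)) :
    pairWeightOn L K Φ G + pairWeightOn L K Φ Gᶜ = pairWeightOn L K Φ Set.univ := by
  unfold pairWeightOn
  rw [← Finset.sum_add_distrib]
  refine Finset.sum_congr rfl fun B _ => ?_
  rw [← ENNReal.tsum_add]
  refine tsum_congr fun j => ?_
  rw [Set.indicator_self_add_compl_apply, Set.indicator_univ]

/-- Sub-additivity of the pair weight of a complement of an intersection. [folklore] -/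
theorem pairWeightOn_compl_inter_le (L : ℝ) (K : ℕ) (Φ : Config (n + 1) → ℝ) (G₁ G₂ : Set (SubIdx K × ℕ)) :
    pairWeightOn L K Φ (G₁ ∩ G₂)ᶜ ≤ pairWeightOn L K Φ G₁ᶜ + pairWeightOn L K Φ G₂ᶜ := by
  unfold pairWeightOn
  rw [← Finset.sum_add_distrib]
  refine Finset.sum_le_sum fun B _ => ?_
  rw [← ENNReal.tsum_add]
  refine ENNReal.tsum_le_tsum fun j => ?_
  by_cases h₁ : (B, j) ∈ G₁
  · by_cases h₂ : (B, j) ∈ G₂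
    · have h : (B, j) ∉ (G₁ ∩ G₂)ᶜ := fun h => h ⟨h₁, h₂⟩
      rw [Set.indicator_of_notMem h]
      exact bot_le
    · have h₂' : (B, j) ∈ G₂ᶜ := h₂
      rw [Set.indicator_of_mem h₂']
      exact (Set.indicator_le_self _ _ _).trans le_add_self
  · have h₁' : (B, j) ∈ G₁ᶜ := h₁
    rw [Set.indicator_of_mem h₁']
    exact (Set.indicator_le_self _ _ _).trans le_self_add

/-- **INS ⟹ MARG functional**: insertion propensity `≥ κ ×` fair share on a pair set `G` gives
`cellCountAffinity ≥ κ^{1/2} · weight(G)`. [folklore] -/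
theorem cellCountAffinity_ge_of_insertion (L : ℝ) (K : ℕ) (Φ : Config (n + 1) → ℝ) (κ : ℝ≥0∞)
    (G : Set (SubIdx K × ℕ))
    (h : ∀ (B : SubIdx K) (j : ℕ), (B, j) ∈ G → κ * pairWeight L K Φ (B, j) ≤ cellMass L K Φ B j) :
    κ ^ (1 / 2 : ℝ) * pairWeightOn L K Φ G ≤ cellCountAffinity L K Φ := by
  have sq_rpow_half : ∀ m : ℝ≥0∞, (m ^ (1 / 2 : ℝ)) ^ 2 = m := fun m => by
    rw [← ENNReal.rpow_two, ← ENNReal.rpow_mul]; norm_num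
  have rpow_half_sq : ∀ m : ℝ≥0∞, (m ^ 2) ^ (1 / 2 : ℝ) = m := fun m => by
    rw [← ENNReal.rpow_two, ← ENNReal.rpow_mul]; norm_num
  unfold pairWeightOn cellCountAffinity
  rw [Finset.mul_sum]
  refine Finset.sum_le_sum fun B _ => ?_
  rw [← ENNReal.tsum_mul_left, ← ENNReal.tsum_mul_left]
  refine ENNReal.tsum_le_tsum fun j => ?_
  by_cases hp : (B, j) ∈ G
  · rw [Set.indicator_of_mem hp]
    have hle := ENNReal.rpow_le_rpow (h B j hp) (show (0 : ℝ) ≤ 1 / 2 by norm_num)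
    have e : (κ * pairWeight L K Φ (B, j)) ^ (1 / 2 : ℝ) =
        κ ^ (1 / 2 : ℝ) * (blockWeight K * cellSlice L K Φ B j ^ (1 / 2 : ℝ)) := by
      unfold pairWeight
      rw [ENNReal.mul_rpow_of_nonneg _ _ (by norm_num), ENNReal.mul_rpow_of_nonneg _ _ (by norm_num),
        rpow_half_sq]
    set s := cellSlice L K Φ B j ^ (1 / 2 : ℝ) with hsdef
    have hs : cellSlice L K Φ B j = s * s := by rw [← sq, hsdef, sq_rpow_half]
    calc κ ^ (1 / 2 : ℝ) * pairWeight L K Φ (B, j)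
        = (blockWeight K * s) * (κ ^ (1 / 2 : ℝ) * (blockWeight K * s)) := by
          unfold pairWeight
          simp only
          rw [hs]; ring
      _ = (blockWeight K * s) * (κ * pairWeight L K Φ (B, j)) ^ (1 / 2 : ℝ) := by rw [e]
      _ ≤ (blockWeight K * s) * cellMass L K Φ B j ^ (1 / 2 : ℝ) := mul_le_mul' le_rfl hle
      _ = blockWeight K * (s * cellMass L K Φ B j ^ (1 / 2 : ℝ)) := mul_assoc _ _ _
  · rw [Set.indicator_of_notMem hp, mul_zero]
    exact bot_le

/-- **MARG ⟹ INS functional** (exactness of the insertion form): if `cellCountAffinity ≥ c` for a normalised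
amplitude, then the pairs with insertion propensity `≥ (c/2)² ×` fair share carry weight `≥ (c/2)²`
(Cauchy–Schwarz on the good pairs, the defining inequality on the bad ones). [folklore] -/
theorem insertion_of_cellCountAffinity {L : ℝ} {K : ℕ} (hL : 0 < L) (hK : 0 < K) {Φ : Config (n + 1) → ℝ}
    (hΦm : Measurable Φ) (hΦ1 : ∫⁻ Y : Config n, ∫⁻ x, ENNReal.ofReal (Φ (Matrix.vecCons x Y)) ^ 2 = 1)
    {c : ℝ≥0∞} (hc : c ≤ cellCountAffinity L K Φ) :
    (c / 2) ^ 2 ≤ pairWeightOn L K Φ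
      {p | (c / 2) ^ 2 * pairWeight L K Φ p ≤ cellMass L K Φ p.1 p.2} := by
  have sq_rpow_half : ∀ m : ℝ≥0∞, (m ^ (1 / 2 : ℝ)) ^ 2 = m := fun m => by
    rw [← ENNReal.rpow_two, ← ENNReal.rpow_mul]; norm_num
  have rpow_half_sq : ∀ m : ℝ≥0∞, (m ^ 2) ^ (1 / 2 : ℝ) = m := fun m => by
    rw [← ENNReal.rpow_two, ← ENNReal.rpow_mul]; norm_num
  set G : Set (SubIdx K × ℕ) := {p | (c / 2) ^ 2 * pairWeight L K Φ p ≤ cellMass L K Φ p.1 p.2} with hGdef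
  have hT : ∀ B : SubIdx K,
      Measurable ((fun m : SubIdx K → ℕ => m B) ∘ countVec (n := n) (L / (K : ℝ)) K) :=
    fun B => (measurable_pi_apply B).comp (measurable_countVec (L / (K : ℝ)) K)
  -- total masses
  have hPW : pairWeightOn L K Φ Set.univ = 1 := pairWeightOn_univ hK hΦ1
  have hMsum : ∑ B : SubIdx K, ∑' j : ℕ, cellMass L K Φ B j ≤ 1 := by
    have hM : ∀ B : SubIdx K, ∑' j : ℕ, cellMass L K Φ B j = ∫⁻ Y, blockMass L K Φ B Y := by
      intro B
      unfold cellMass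
      rw [← lintegral_eq_tsum_fibre volume (hT B) (blockMass L K Φ B)]
    simp_rw [hM]
    rw [← lintegral_finsetSum _ fun B _ => measurable_blockMass L K hΦm B]
    calc ∫⁻ Y, ∑ B : SubIdx K, blockMass L K Φ B Y ≤ ∫⁻ Y : Config n, sliceSq Φ Y :=
          lintegral_mono fun Y => sum_blockMass_le_sliceSq hL hK hΦm Y
      _ = 1 := hΦ1
  -- pointwise split of the affinity term
  have hpt : ∀ (B : SubIdx K) (j : ℕ),
      blockWeight K * (cellSlice L K Φ B j ^ (1 / 2 : ℝ) * cellMass L K Φ B j ^ (1 / 2 : ℝ)) ≤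
        (G.indicator (pairWeight L K Φ) (B, j)) ^ (1 / 2 : ℝ) * cellMass L K Φ B j ^ (1 / 2 : ℝ) +
          c / 2 * Gᶜ.indicator (pairWeight L K Φ) (B, j) := by
    intro B j
    have ew : (pairWeight L K Φ (B, j)) ^ (1 / 2 : ℝ) = blockWeight K * cellSlice L K Φ B j ^ (1 / 2 : ℝ) := by
      unfold pairWeight
      rw [ENNReal.mul_rpow_of_nonneg _ _ (by norm_num), rpow_half_sq]
    by_cases hp : (B, j) ∈ G
    · have hpc : (B, j) ∉ Gᶜ := fun h => h hp
      rw [Set.indicator_of_mem hp, Set.indicator_of_notMem hpc, mul_zero, add_zero, ew, mul_assoc]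
    · have hpc : (B, j) ∈ Gᶜ := hp
      rw [Set.indicator_of_notMem hp, Set.indicator_of_mem hpc, ENNReal.zero_rpow_of_pos (by norm_num),
        zero_mul, zero_add]
      have hlt : cellMass L K Φ B j < (c / 2) ^ 2 * pairWeight L K Φ (B, j) := by
        rw [hGdef] at hp
        simp only [Set.mem_setOf_eq, not_le] at hp
        exact hp
      have hle := ENNReal.rpow_le_rpow hlt.le (show (0 : ℝ) ≤ 1 / 2 by norm_num)
      rw [ENNReal.mul_rpow_of_nonneg _ _ (by norm_num), rpow_half_sq, ew] at hle
      set s := cellSlice L K Φ B j ^ (1 / 2 : ℝ) with hsdef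
      have hs : cellSlice L K Φ B j = s * s := by rw [← sq, hsdef, sq_rpow_half]
      calc blockWeight K * (s * cellMass L K Φ B j ^ (1 / 2 : ℝ))
          ≤ blockWeight K * (s * (c / 2 * (blockWeight K * s))) := by gcongr
        _ = c / 2 * pairWeight L K Φ (B, j) := by
          unfold pairWeight
          simp only
          rw [hs]; ring
  -- sum the pointwise bound
  have hA : cellCountAffinity L K Φ ≤
      (∑ B : SubIdx K, ∑' j : ℕ,
        (G.indicator (pairWeight L K Φ) (B, j)) ^ (1 / 2 : ℝ) * cellMass L K Φ B j ^ (1 / 2 : ℝ)) +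
        c / 2 * pairWeightOn L K Φ Gᶜ := by
    unfold cellCountAffinity pairWeightOn
    rw [Finset.mul_sum, ← Finset.sum_add_distrib]
    refine Finset.sum_le_sum fun B _ => ?_
    rw [← ENNReal.tsum_mul_left, ← ENNReal.tsum_mul_left, ← ENNReal.tsum_add]
    exact ENNReal.tsum_le_tsum fun j => hpt B j
  -- Cauchy–Schwarz on the good part
  have hCS : (∑ B : SubIdx K, ∑' j : ℕ,
      (G.indicator (pairWeight L K Φ) (B, j)) ^ (1 / 2 : ℝ) * cellMass L K Φ B j ^ (1 / 2 : ℝ)) ≤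
      (pairWeightOn L K Φ G) ^ (1 / 2 : ℝ) * (∑ B : SubIdx K, ∑' j : ℕ, cellMass L K Φ B j) ^ (1 / 2 : ℝ) := by
    calc (∑ B : SubIdx K, ∑' j : ℕ,
          (G.indicator (pairWeight L K Φ) (B, j)) ^ (1 / 2 : ℝ) * cellMass L K Φ B j ^ (1 / 2 : ℝ))
        ≤ ∑ B : SubIdx K, (∑' j : ℕ, G.indicator (pairWeight L K Φ) (B, j)) ^ (1 / 2 : ℝ) *
            (∑' j : ℕ, cellMass L K Φ B j) ^ (1 / 2 : ℝ) :=
          Finset.sum_le_sum fun B _ => tsum_rpow_half_mul_le _ _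
      _ ≤ (∑ B : SubIdx K, ((∑' j : ℕ, G.indicator (pairWeight L K Φ) (B, j)) ^ (1 / 2 : ℝ)) ^ 2) ^
              (1 / 2 : ℝ) * (∑ B : SubIdx K, ∑' j : ℕ, cellMass L K Φ B j) ^ (1 / 2 : ℝ) :=
          sum_mul_rpow_half_le _ _ _
      _ = (pairWeightOn L K Φ G) ^ (1 / 2 : ℝ) *
            (∑ B : SubIdx K, ∑' j : ℕ, cellMass L K Φ B j) ^ (1 / 2 : ℝ) := by
          unfold pairWeightOn
          simp_rw [sq_rpow_half]
  -- assemble: c ≤ P_G^{1/2} + c/2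
  have hc1 : c ≤ 1 := hc.trans (cellCountAffinity_le_one hL hK hΦm hΦ1)
  have hcfin : c / 2 ≠ ∞ := ENNReal.div_ne_top (ne_top_of_le_ne_top ENNReal.one_ne_top hc1) two_ne_zero
  have hGc : pairWeightOn L K Φ Gᶜ ≤ 1 := by
    rw [← hPW, ← pairWeightOn_add_compl L K Φ G]
    exact le_add_self
  have key : c / 2 + c / 2 ≤ (pairWeightOn L K Φ G) ^ (1 / 2 : ℝ) + c / 2 := by
    calc c / 2 + c / 2 = c := ENNReal.add_halves c
      _ ≤ cellCountAffinity L K Φ := hc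
      _ ≤ (pairWeightOn L K Φ G) ^ (1 / 2 : ℝ) * (∑ B : SubIdx K, ∑' j : ℕ, cellMass L K Φ B j) ^ (1 / 2 : ℝ) +
            c / 2 * pairWeightOn L K Φ Gᶜ := hA.trans (add_le_add hCS le_rfl)
      _ ≤ (pairWeightOn L K Φ G) ^ (1 / 2 : ℝ) * 1 + c / 2 * 1 := by
          gcongr
          · calc (∑ B : SubIdx K, ∑' j : ℕ, cellMass L K Φ B j) ^ (1 / 2 : ℝ) ≤ (1 : ℝ≥0∞) ^ (1 / 2 : ℝ) :=
                  ENNReal.rpow_le_rpow hMsum (by norm_num)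
              _ = 1 := ENNReal.one_rpow _
      _ = (pairWeightOn L K Φ G) ^ (1 / 2 : ℝ) + c / 2 := by rw [mul_one, mul_one]
  have hhalf : c / 2 ≤ (pairWeightOn L K Φ G) ^ (1 / 2 : ℝ) := (ENNReal.add_le_add_iff_right hcfin).1 key
  calc (c / 2) ^ 2 ≤ ((pairWeightOn L K Φ G) ^ (1 / 2 : ℝ)) ^ 2 := pow_le_pow_left' hhalf 2
    _ = pairWeightOn L K Φ G := sq_rpow_half _

/-- **INS_h(η)** (crux · TAG EQUIVALENT to MARG_h(η) (`horizonCellInsertion_iff_cellCountAffinity`) — the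
residual of record in POINTWISE form) `GroundStateHorizonCellInsertion η`: at all sufficiently coarse horizon
windows there is a set `G` of (cell, count) pairs of weight `Σ_G K^{-3} P̄_B(j) ≥ δ` on which the insertion
propensity of the tagged particle into `B`, given that the others have `j` particles in `B`, is at least `κ ×` the
fair share: `Q_B(j) ≥ κ · K^{-3} · P̄_B(j)` (for a symmetric state: `p_B(j+1)/p_B(j) ≥ κ' λ_B/(j+1)` on pairs of
positive `p_B`-weight — the law of `N_B` does not drop by more than a constant factor under ONE added particle).
Fails in the number-locked (Mott) and single-cell parity-locked models; heuristic value `κ = 1 − o(1)`.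
[cite: LSSY2005, Thm 7.1; GhoshPeres2017, DOI 10.1215/00127094-2017-0002] -/
@[conjecture] def GroundStateHorizonCellInsertion (η : ℝ≥0) : Prop :=
  ∀ v : ℝ → ℝ≥0∞, IsRepulsiveFiniteRange v → 0 < scatteringLength v →
    ∃ M₀ : ℝ, 0 < M₀ ∧ ∀ M : ℝ, M₀ ≤ M → ∃ κ : ℝ, 0 < κ ∧ ∃ δ : ℝ, 0 < δ ∧ ∃ ρ₀ : ℝ, 0 < ρ₀ ∧
      ∀ ρ : ℝ, 0 < ρ → ρ < ρ₀ → ∀ᶠ n : ℕ in atTop,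
        (∃ Ψ₀ : Config (n + 1) → ℝ, (∀ X, 0 ≤ Ψ₀ X) ∧
          IsGroundState v (sideLength ρ (n + 1)) (fun X => (Ψ₀ X : ℂ))) →
        ∀ K : ℕ, 0 < K → InWindow (M * ρ ^ (-(η : ℝ))) ρ (sideLength ρ (n + 1)) K →
          ∃ G : Set (SubIdx K × ℕ),
            ENNReal.ofReal δ ≤
                pairWeightOn (sideLength ρ (n + 1)) K (groundState v (n + 1) (sideLength ρ (n + 1))) G ∧
              ∀ (B : SubIdx K) (j : ℕ), (B, j) ∈ G →
                ENNReal.ofReal κ *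
                    pairWeight (sideLength ρ (n + 1)) K (groundState v (n + 1) (sideLength ρ (n + 1))) (B, j) ≤
                  cellMass (sideLength ρ (n + 1)) K (groundState v (n + 1) (sideLength ρ (n + 1))) B j

/-- **INS_h ⟹ MARG_h** (`c = κ^{1/2} δ`). [folklore] -/
theorem horizonCellCountAffinity_of_insertion (η : ℝ≥0) (hins : GroundStateHorizonCellInsertion η) :
    GroundStateHorizonCellCountAffinity η := by
  intro v hv ha
  obtain ⟨M₀, hM₀, h⟩ := hins v hv ha
  refine ⟨M₀, hM₀, fun M hM => ?_⟩
  obtain ⟨κ, hκ, δ, hδ, ρ₀, hρ₀, h'⟩ := h M hM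
  refine ⟨κ ^ (1 / 2 : ℝ) * δ, mul_pos (Real.rpow_pos_of_pos hκ _) hδ, ρ₀, hρ₀, fun ρ hρ hρlt => ?_⟩
  filter_upwards [h' ρ hρ hρlt] with n hn hex K hK hKw
  obtain ⟨G, hG, hI⟩ := hn hex K hK hKw
  set L := sideLength ρ (n + 1) with hLdef
  set Φ := groundState v (n + 1) L with hΦdef
  calc ENNReal.ofReal (κ ^ (1 / 2 : ℝ) * δ) = ENNReal.ofReal κ ^ (1 / 2 : ℝ) * ENNReal.ofReal δ := by
        rw [ENNReal.ofReal_mul (Real.rpow_nonneg hκ.le _), ENNReal.ofReal_rpow_of_nonneg hκ.le (by norm_num)]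
    _ ≤ ENNReal.ofReal κ ^ (1 / 2 : ℝ) * pairWeightOn L K Φ G := mul_le_mul' le_rfl hG
    _ ≤ cellCountAffinity L K Φ := cellCountAffinity_ge_of_insertion L K Φ _ G hI

/-- **MARG_h ⟹ INS_h** (`κ = δ = (c/2)²`): the insertion form is EXACT. [folklore] -/
theorem horizonCellInsertion_of_cellCountAffinity (η : ℝ≥0) (hmarg : GroundStateHorizonCellCountAffinity η) :
    GroundStateHorizonCellInsertion η := by
  intro v hv ha
  obtain ⟨M₀, hM₀, h⟩ := hmarg v hv ha
  refine ⟨M₀, hM₀, fun M hM => ?_⟩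
  obtain ⟨c, hc, ρ₀, hρ₀, h'⟩ := h M hM
  refine ⟨(c / 2) ^ 2, by positivity, (c / 2) ^ 2, by positivity, ρ₀, hρ₀, fun ρ hρ hρlt => ?_⟩
  filter_upwards [h' ρ hρ hρlt] with n hn hex K hK hKw
  have hA : 0 < M * ρ ^ (-(η : ℝ)) := mul_pos (hM₀.trans_le hM) (Real.rpow_pos_of_pos hρ _)
  set L := sideLength ρ (n + 1) with hLdef
  have hL : 0 < L := sideLength_pos_of_inWindow hA hρ hK hKw
  set Φ := groundState v (n + 1) L with hΦdef
  have hΦm : Measurable Φ := measurable_groundState v (n + 1) L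
  have hΦ1 : ∫⁻ Y : Config n, ∫⁻ x, ENNReal.ofReal (Φ (Matrix.vecCons x Y)) ^ 2 = 1 := by
    rw [← lintegral_eq_lintegral_lintegral_vecCons (hΦm.ennreal_ofReal.pow_const 2)]
    exact lintegral_groundState_sq hex
  have hcE : ENNReal.ofReal ((c / 2) ^ 2) = (ENNReal.ofReal c / 2) ^ 2 := by
    rw [ENNReal.ofReal_pow (by positivity), ENNReal.ofReal_div_of_pos two_pos, ENNReal.ofReal_ofNat]
  refine ⟨{p | (ENNReal.ofReal c / 2) ^ 2 * pairWeight L K Φ p ≤ cellMass L K Φ p.1 p.2}, ?_, ?_⟩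
  · rw [hcE]
    exact insertion_of_cellCountAffinity hL hK hΦm hΦ1 (hn hex K hK hKw)
  · intro B j hp
    rw [hcE]
    exact hp

/-- **EXACTNESS OF THE INSERTION FORM**: INS_h(η) ⟺ MARG_h(η). [folklore] -/
theorem horizonCellInsertion_iff_cellCountAffinity (η : ℝ≥0) :
    GroundStateHorizonCellInsertion η ↔ GroundStateHorizonCellCountAffinity η :=
  ⟨horizonCellCountAffinity_of_insertion η, horizonCellInsertion_of_cellCountAffinity η⟩

end Summit.AtomisticToContinuum.BoseEinsteinCondensation.Theorems.BoxCountShadow
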